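import Mathlib
import HarnessLib.Audit
import Summits.PneNP.PneNP.Theorems.PstarUnionCaseA

/-!
# Forcing is trivial in rank six — the rank-four-reader case of (R6) (ROUND-24, memo §14.16–§14.18; ASK T-UNION-TRI)

FRONTIER range-avoidance ladder, rung F-N3, ROUND 24 (cell `pnp-ideate`, planner memo `r24/CORE-BOUND-NOTES.md` §14.16–§14.18, typed sketch `r24/SketchCaseA.lean` of planner
p3 g22, statement (R6); restricted-model proof complexity — nothing here bears on `P` versus `NP`).

* `forcing_trivial_of_rank_six_of_rank_four` — **(R6) for readers of rank ≥ 4**: `q` of polar rank `≥ 6`, `f` quadratic of polar rank `≥ 4`, `f = c` on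
  `Z(q) ≠ ∅` ⟹ `f ≡ c` or `f = q + κ`.  `PstarForcing.forcing_cases` leaves EQ; the elliptic exception `f = q + ν₁ν₂ + κ` makes `ν₁ν₂` constant on `Z(q)`, so `q = 1`
  on the flat `{ν₁ = ν₂ = 1}` or on a hyperplane `{νᵢ = 0}` — rank `≤ 4` by (R4) `PstarUnionCaseA.rank_le_four_of_const_on_flat` — unless these are empty, which folds
  into EQ; NOR is excluded by `not_rank_four_of_mul`; `Z(q) = ∅` by `hZ`.
  (p3's full (R6) also covers readers of rank ≤ 2 via the structure `f = μ₁μ₂ + α`; that half is not typed here.)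
-/

set_option linter.dupNamespace false -- `Summit.PneNP.PneNP.…`: summit = sub-problem name (D-0017 single-conjunct layout)

open Module
open Summit.PneNP.PneNP.Theorems.PstarCubeIdeals (IsAffineFn IsQuadFn)
open Summit.PneNP.PneNP.Theorems.PstarQuadRank (rad mem_rad)
open Summit.PneNP.PneNP.Theorems.PstarForcing (forcing_cases not_rank_four_of_mul)
open Summit.PneNP.PneNP.Theorems.PstarRankRigidityFour (classification)
open Summit.PneNP.PneNP.Theorems.PstarUnionCaseA (rank_le_four_of_const_on_flat)

namespace Summit.PneNP.PneNP.Theorems.PstarUnionRankSix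

variable {M : Type*} [AddCommGroup M] [Module (ZMod 2) M] [Fintype M]

omit [Fintype M] in
/-- `x ↦ B x b + κ` is affine. -/
theorem isAffineFn_polar_left (B : LinearMap.BilinForm (ZMod 2) M) (b : M) (κ : ZMod 2) : IsAffineFn fun x => B x b + κ := by
  intro x w
  show B (x + w) b + κ = (B x b + κ) + (B w b + κ) + (B 0 b + κ)
  rw [map_add B, LinearMap.add_apply, map_zero B, LinearMap.zero_apply, zero_add]
  have : κ + κ = 0 := by revert κ; decide
  linear_combination (-1 : ZMod 2) * this

omit [Module (ZMod 2) M] [Fintype M] in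
/-- Shifting an affine function by a constant keeps it affine. -/
theorem isAffineFn_add_const {ν : M → ZMod 2} (hν : IsAffineFn ν) (κ : ZMod 2) : IsAffineFn fun x => ν x + κ := by
  intro x w
  show ν (x + w) + κ = (ν x + κ) + (ν w + κ) + (ν 0 + κ)
  rw [hν x w]
  have : κ + κ = 0 := by revert κ; decide
  linear_combination (-1 : ZMod 2) * this

omit [Module (ZMod 2) M] [Fintype M] in
/-- Constants are affine. -/
theorem isAffineFn_const (κ : ZMod 2) : IsAffineFn fun _ : M => κ := by
  intro _ _
  have : κ + κ = 0 := by revert κ; decide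
  linear_combination (-1 : ZMod 2) * this

/-- **(R6), rank-four readers.**  If `q` has polar rank `≥ 6` and `f` has polar rank `≥ 4`, then `f` constant on `{q = 0} ≠ ∅` forces `f ≡ c` or `f = q + κ`. -/
theorem forcing_trivial_of_rank_six_of_rank_four {q f : M → ZMod 2} {B B' : LinearMap.BilinForm (ZMod 2) M}
    (hB : ∀ x w, q (x + w) = q x + q w + q 0 + B x w) (hB' : ∀ x w, f (x + w) = f x + f w + f 0 + B' x w)
    (hrank : finrank (ZMod 2) (rad B) + 6 ≤ finrank (ZMod 2) M) (hrank' : finrank (ZMod 2) (rad B') + 4 ≤ finrank (ZMod 2) M)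
    (hZ : ∃ x, q x = 0) {c : ZMod 2} (hconst : ∀ x, q x = 0 → f x = c) :
    (∀ x, f x = c) ∨ (∃ κ : ZMod 2, ∀ x, f x = q x + κ) := by
  classical
  have h01 : ∀ a : ZMod 2, a ≠ 0 → a = 1 := by decide
  have hmul : ∀ a b : ZMod 2, a * b = 1 ↔ a = 1 ∧ b = 1 := by decide
  have two0 : ∀ a : ZMod 2, a + a = 0 := by decide
  obtain ⟨x₀, hx₀⟩ := hZ
  rcases forcing_cases hB hB' hrank' hconst with hall | hEQ | ⟨ν₁, ν₂, hν₁, hν₂, κ, hf⟩ | ⟨a, b, -, hq, -⟩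
  · exact absurd (hall x₀) (by rw [hx₀]; exact zero_ne_one)
  · exact Or.inr hEQ
  · -- the elliptic exception: `ν₁ν₂ = c + κ` on `Z(q)`
    have hZ' : ∀ x, q x = 0 → ν₁ x * ν₂ x = c + κ := by
      intro x hx
      have := hf x; rw [hconst x hx, hx, zero_add] at this
      linear_combination (-1 : ZMod 2) * this + (-1 : ZMod 2) * two0 κ
    have hlt : ¬ finrank (ZMod 2) M ≤ finrank (ZMod 2) (rad B) + 4 := by omega
    rcases (by decide : ∀ d : ZMod 2, d = 0 ∨ d = 1) (c + κ) with hd | hd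
    · -- `q = 1` on the flat `{ν₁ = 1, ν₂ = 1}` unless it is empty
      by_cases hne : ∃ h, ν₁ h = 1 ∧ ν₂ h = 1
      · refine absurd (rank_le_four_of_const_on_flat hB hν₁ hν₂ hne fun x x' h1 h2 h1' h2' => ?_) hlt
        have hq1 : ∀ z, ν₁ z = 1 → ν₂ z = 1 → q z = 1 := fun z hz1 hz2 =>
          h01 _ fun hz => by have := hZ' z hz; rw [hz1, hz2, hd, mul_one] at this; exact one_ne_zero this
        rw [hq1 x h1 h2, hq1 x' h1' h2']
      · right
        refine ⟨κ, fun x => ?_⟩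
        rw [hf x]
        have : ν₁ x * ν₂ x = 0 := by
          by_contra hne0
          exact hne ⟨x, (hmul _ _).1 (h01 _ hne0)⟩
        rw [this, add_zero]
    · -- `Z(q) ⊆ {ν₁ = 1} ∩ {ν₂ = 1}`: `q = 1` on each hyperplane `{νᵢ = 0}` unless it is empty
      have hZ1 : ∀ z, q z = 0 → ν₁ z = 1 ∧ ν₂ z = 1 := fun z hz => (hmul _ _).1 (by rw [hZ' z hz, hd])
      have hyper : ∀ {ν : M → ZMod 2}, IsAffineFn ν → (∀ z, q z = 0 → ν z = 1) → (∀ z, ν z = 1) := by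
        intro ν hν hνZ z
        by_contra hz0
        have hz0' : ν z = 0 := by rcases (by decide : ∀ d : ZMod 2, d = 0 ∨ d = 1) (ν z) with h | h; exact h; exact absurd h hz0
        refine hlt (rank_le_four_of_const_on_flat hB (isAffineFn_add_const hν 1) (isAffineFn_const 1) ⟨z, by rw [hz0']; decide, rfl⟩
          fun x x' h1 _ h1' _ => ?_)
        have e : ∀ w, ν w + 1 = 1 → q w = 1 := fun w hw =>
          h01 _ fun hq0 => by have := hνZ w hq0; rw [this] at hw; exact absurd hw (by decide)
        rw [e x h1, e x' h1']
      have h1 := hyper hν₁ fun z hz => (hZ1 z hz).1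
      have h2 := hyper hν₂ fun z hz => (hZ1 z hz).2
      right
      refine ⟨κ + 1, fun x => ?_⟩
      rw [hf x, h1 x, h2 x]; ring
  · -- NOR: `q` is a product of two affine functions plus one — rank ≤ 2
    exact absurd (by omega) (not_rank_four_of_mul hB (isAffineFn_polar_left B b (q b + q 0)) (isAffineFn_polar_left B a (q a + q 0)) (κ := 1) hq)

/-! ## (R6) for readers of every rank

The tree's rank rigidity theorem `PstarRankRigidity.eq_zero_or_eq_of_rank_six` carries NO rank hypothesis on the vanishing quadratic, so the full (R6) of
the planner's sketch (`r24/SketchCaseA.lean`, planner p3 g22 19:11:00Z / 19:24:00Z) follows at once — superseding the rank-`≥ 4` restriction of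
`forcing_trivial_of_rank_six_of_rank_four` and the header's remark that the rank-`≤ 2` half is untyped: apply it to `g := f + c`.  The sketch's hypothesis
`Z(q) ≠ ∅` is dropped (it is automatic in rank `≥ 6` and not needed by the proof). -/

/-- **(R6) Forcing is trivial in rank six — readers of every rank.**  If `q` has polar rank `≥ 6` (`dim rad B + 6 ≤ dim M`) and the quadratic `f` is
constant `= c` on `{q = 0}`, then `f ≡ c` or `f = q + κ` for a constant `κ`.  No rank hypothesis on `f`. -/
theorem forcing_trivial_of_rank_six {q f : M → ZMod 2} {B B' : LinearMap.BilinForm (ZMod 2) M}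
    (hB : ∀ x w, q (x + w) = q x + q w + q 0 + B x w) (hB' : ∀ x w, f (x + w) = f x + f w + f 0 + B' x w)
    (hrank : finrank (ZMod 2) (rad B) + 6 ≤ finrank (ZMod 2) M) {c : ZMod 2} (hconst : ∀ x, q x = 0 → f x = c) :
    (∀ x, f x = c) ∨ (∃ κ : ZMod 2, ∀ x, f x = q x + κ) := by
  classical
  have two0 : ∀ a : ZMod 2, a + a = 0 := by decide
  have hg : IsQuadFn fun x => f x + c := by
    refine ⟨B', fun x w => ?_⟩
    show f (x + w) + c = (f x + c) + (f w + c) + (f 0 + c) + B' x w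
    rw [hB' x w]
    linear_combination (-1 : ZMod 2) * two0 c
  have hZ : ∀ x, q x = 0 → (fun x => f x + c) x = 0 := fun x hx => by
    show f x + c = 0
    rw [hconst x hx, two0 c]
  have back : ∀ x, f x = (f x + c) + c := fun x => by rw [add_assoc, two0 c, add_zero]
  rcases PstarRankRigidity.eq_zero_or_eq_of_rank_six hB hrank hg hZ with h0 | hq
  · left
    intro x
    rw [back x, h0 x, zero_add]
  · right
    refine ⟨c, fun x => ?_⟩
    rw [back x, hq x]

/-! ## Kernel triviality when `{q = 1}` contains no flat of codimension two

Planner p3 g22 (STATUS 19:55:11Z, world (α) of the Case-A split): if `{q = 1}` contains NO non-empty flat `{μ₁ = μ₂ = 1}` of codimension `≤ 2` (hyperplanes and the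
whole space included: take `μ₂ := 1`), then the kernel `K(q) = {g quadratic : g ≡ 0 on Z(q)}` is `{0, q}` — immediate from the R7 case table
`PstarRankRigidityFour.classification`: its product branches `g = μ₁μ₂` / `q + g = μ₁μ₂` put `{μ₁ = μ₂ = 1}` inside `{q = 1}` (so the product vanishes identically), and its
NOR branch `q = μ₁μ₂ + 1` puts the hyperplane `{μ₁ = 0}` inside `{q = 1}`.  Rank `≥ 6` is the special case (R4); hyperbolic rank four, graph types `q′ + ℓ` and `q = μ₁μ₂`
are (α) too. -/

/-- **Kernel triviality, no-flat form.**  `q` quadratic and non-constant whose one-set `{q = 1}` contains no non-empty flat `{μ₁ = μ₂ = 1}` (`μᵢ` affine); then every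
quadratic `g` vanishing on `Z(q)` is `0` or `q`. -/
theorem kernel_trivial_of_no_flat {q : M → ZMod 2} {B : LinearMap.BilinForm (ZMod 2) M}
    (hB : ∀ x w, q (x + w) = q x + q w + q 0 + B x w) (hq : ∃ v, q v ≠ q 0)
    (hnf : ∀ μ₁ μ₂ : M → ZMod 2, IsAffineFn μ₁ → IsAffineFn μ₂ → (∃ h, μ₁ h = 1 ∧ μ₂ h = 1) → ∃ x, μ₁ x = 1 ∧ μ₂ x = 1 ∧ q x = 0)
    {g : M → ZMod 2} (hg : IsQuadFn g) (hZ : ∀ x, q x = 0 → g x = 0) : (∀ x, g x = 0) ∨ (∀ x, g x = q x) := by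
  classical
  have hmul : ∀ a b : ZMod 2, a * b = 1 ↔ a = 1 ∧ b = 1 := by decide
  have h01 : ∀ a : ZMod 2, a ≠ 1 → a = 0 := by decide
  have h10 : ∀ a : ZMod 2, a ≠ 0 → a = 1 := by decide
  -- a product of two affine functions vanishing wherever `q` does vanishes identically
  have key : ∀ {μ₁ μ₂ : M → ZMod 2}, IsAffineFn μ₁ → IsAffineFn μ₂ → (∀ x, q x = 0 → μ₁ x * μ₂ x = 0) → ∀ x, μ₁ x * μ₂ x = 0 := by
    intro μ₁ μ₂ h₁ h₂ hv x
    by_contra hx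
    obtain ⟨hx1, hx2⟩ := (hmul _ _).1 (h10 _ hx)
    obtain ⟨z, hz1, hz2, hzq⟩ := hnf μ₁ μ₂ h₁ h₂ ⟨x, hx1, hx2⟩
    have := hv z hzq
    rw [hz1, hz2, mul_one] at this
    exact one_ne_zero this
  rcases classification hB hq hg hZ with h | ⟨μ₁, μ₂, h₁, h₂, hprod | hprod⟩ | ⟨a, b, hab, hqab, -⟩
  · exact h
  · -- `g = μ₁ μ₂`
    left
    have hv : ∀ x, q x = 0 → μ₁ x * μ₂ x = 0 := fun x hx => by rw [← hprod x]; exact hZ x hx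
    intro x
    rw [hprod x]
    exact key h₁ h₂ hv x
  · -- `q + g = μ₁ μ₂`
    right
    have hv : ∀ x, q x = 0 → μ₁ x * μ₂ x = 0 := fun x hx => by rw [← hprod x, hZ x hx, hx, add_zero]
    intro x
    have e := hprod x
    rw [key h₁ h₂ hv x] at e
    have : ∀ a b : ZMod 2, a + b = 0 → b = a := by decide
    exact this _ _ e
  · -- NOR: the hyperplane `{μ₁ = 0}` lies inside `{q = 1}`
    exfalso
    have hμ₁ : IsAffineFn fun x => B x b + (q b + q 0) + 1 := isAffineFn_add_const (isAffineFn_polar_left B b (q b + q 0)) 1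
    -- the hyperplane is non-empty: `μ₁ a = μ₁ 0 + 1` since `B a b = 1`
    have hne : ∃ h, B h b + (q b + q 0) + 1 = 1 ∧ (fun _ : M => (1 : ZMod 2)) h = 1 := by
      rcases (by decide : ∀ d : ZMod 2, d = 0 ∨ d = 1) (q b + q 0) with hd | hd
      · exact ⟨0, by rw [map_zero B, LinearMap.zero_apply, hd]; decide, rfl⟩
      · exact ⟨a, by rw [hab, hd]; decide, rfl⟩
    obtain ⟨x, hx1, -, hxq⟩ := hnf _ _ hμ₁ (isAffineFn_const 1) hne
    have hq1 := hqab x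
    have hx0 : B x b + (q b + q 0) = 0 := by
      have : ∀ d : ZMod 2, d + 1 = 1 → d = 0 := by decide
      exact this _ hx1
    rw [hxq, hx0, zero_mul, zero_add] at hq1
    exact zero_ne_one hq1

end Summit.PneNP.PneNP.Theorems.PstarUnionRankSix
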